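import Summits.NavierStokesRegularity.NavierStokesRegularity.Theorems.CircuitPump.Negative.WitnessStructure

/-!
# `CircuitPump` (stmt-NavierStokesRegularity-1834): energy conservation is load-bearing — an explicit
# non-conservative pump at `lam = 2^{5/4}`

Negative-side load-bearing analysis for the crux `PerpetualPump.CircuitPump` (cdisprove seat, cycle 2; work file
`Cruxes/CircuitPump/Disproof.lean` §(a4)). Cycle 1 (`Negative/LoadBearing.lean`) showed that deleting any one of
the clauses ODE / Type I / nontrivial makes the crux trivially true, and left open whether the remaining
ANALYTIC conjunction `SolvesODE ∧ IsDSS ∧ IsTypeI ∧ IsNontrivial` is consistent at all inside Tao's symmetric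
class once cyclic cancellation (energy conservation of the nonlinearity) is dropped. IT IS, in closed form, at the
scale ratio `lam = 2^{5/4}` (`lam^{4/5} = 2`):

* `feedCoeff c` — the `m = 1` FEED-FORWARD circuit `Ẋ_n = -lam^{4n/5} X_n + c·lam^{n-1} X_{n-1}²` (only the offset
  `(0,0,1)` is switched on; Tao-symmetric (`isSym_feedCoeff`) but NOT cyclic-cancelling (`not_isCyc_feedCoeff`):
  energy is injected scale by scale);
* `expX lam` — the profile `X_n(t) = lam^{-n/5} exp(lam^{4n/5} t)`: it DECAYS into the past (the opposite time
  orientation to the free viscous mode `lam^{-n/5}exp(-lam^{4n/5}t)` of `LoadBearing.freeX`), is exactly 1-DSS for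
  every `lam` (`expX_dss`), is Type I with constant `1` for every `lam` (`expX_typeI`: `√s e^{-s} ≤ 1`), and solves the
  feed-forward circuit with `c = 2 lam^{3/5}` exactly when `lam^{4/5} = 2` (`expX_solves`: the forcing
  `X_{n-1}² ∝ exp(2·lam^{4(n-1)/5} t)` resonates with `exp(lam^{4n/5}t)` iff `lam^{4/5} = 2`);
* `withoutCycAbove_holds` — hence `WithoutCycAbove (2^{5/4})`: for every `lam₀ > 2^{5/4}` there is `lam ∈ (1,lam₀)`
  (namely `2^{5/4}`) and a symmetric circuit with a nontrivial, exactly DSS, Type-I, ANCIENT solution. The crux with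
  `IsCyc` deleted is `WithoutCycAbove 1`; whether it holds (fine `lam`) stays open, but NOT in closed form: for a
  solution by exponential monomials `X_{i,n} = a_{i,n}e^{β_{i,n}t}` of ANY circuit of the class (any `m`, any period
  `k`, conservative or not) the minimal rate at scale `n+1` is fed from scale `n` by a product of two modes, so
  `min_i β_{i,n+1} ≥ 2 min_i β_{i,n}`, and DSS (`β_{i,n+k} = lam^{4k/5}β_{i,n}`) forces `lam^{4/5} ≥ 2` (paper remark
  in the work file).

CONSEQUENCE FOR DISPROOF ATTEMPTS: any proof of `¬CircuitPump` must use the cyclic cancellation `IsCyc` (or the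
fineness `lam < 2^{5/4}`): the four analytic clauses are jointly satisfiable in the symmetric class. Sorry-free.
-/

set_option linter.dupNamespace false

noncomputable section

open scoped BigOperators
open Real Set

namespace Summit.NavierStokesRegularity.NavierStokesRegularity.Theorems.CircuitPumpNegative

/-- The crux with cyclic cancellation deleted and the fineness threshold `1` replaced by `l`:
`WithoutCycAbove 1` is literally `CircuitPump` minus `IsCyc`. -/
def WithoutCycAbove (l : ℝ) : Prop :=
  ∀ lam₀ : ℝ, l < lam₀ → ∃ lam : ℝ, 1 < lam ∧ lam < lam₀ ∧
    ∃ (m : ℕ) (coeff : Fin m → Fin m → Fin m → Option (Fin 3) → ℝ) (k : ℕ) (X : Fin m → ℤ → ℝ → ℝ),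
      IsSym coeff ∧ 1 ≤ k ∧ SolvesODE lam coeff X ∧ IsDSS lam k X ∧ IsTypeI lam X ∧ IsNontrivial X

/-- The feed-forward structure constants: only the offset label `(0,0,1)` (`some 2`) is on. -/
def feedCoeff (c : ℝ) : Fin 1 → Fin 1 → Fin 1 → Option (Fin 3) → ℝ :=
  fun _ _ _ μ => if μ = some 2 then c else 0

/-- The feed-forward circuit is Tao-symmetric (the swap of the first two offset coordinates fixes `(0,0,1)`). -/
theorem isSym_feedCoeff (c : ℝ) : IsSym (feedCoeff c) := by
  intro i₁ i₂ i₃ μ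
  rcases μ with _ | j
  · simp [feedCoeff]
  · fin_cases j <;> simp [feedCoeff, Equiv.swap_apply_of_ne_of_ne]

/-- The feed-forward circuit is NOT cyclic-cancelling (it does not conserve energy): the cyclic sum at the
label `(0,0,1)` is `2c`. -/
theorem not_isCyc_feedCoeff {c : ℝ} (hc : c ≠ 0) : ¬ IsCyc (feedCoeff c) := by
  intro h
  have := h (fun _ => 0) (some 2)
  rw [sum_perm_fin_three] at this
  have e0 : (Equiv.symm (1 : Equiv.Perm (Fin 3))) = 1 := by decide
  have e1 : (Equiv.swap (0 : Fin 3) 1 * Equiv.swap 1 2).symm = Equiv.swap 1 2 * Equiv.swap 0 1 := by decide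
  have e2 : (Equiv.swap (1 : Fin 3) 2 * Equiv.swap 0 1).symm = Equiv.swap 0 1 * Equiv.swap 1 2 := by decide
  simp [feedCoeff, Equiv.swap_apply_of_ne_of_ne, Equiv.swap_apply_right,
    Equiv.symm_swap, e0, e1, e2, Equiv.Perm.coe_one] at this
  exact hc (by linarith)

/-- The feed-forward right-hand side: `F_n = -lam^{4n/5}X_n + c·lam^{n-1}·X_{n-1}²`. -/
theorem feed_rhs (lam c : ℝ) (X : Fin 1 → ℤ → ℝ → ℝ) (n : ℤ) (t : ℝ) :
    rhsF lam (feedCoeff c) X 0 n t =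
      -(lam ^ ((4 / 5 : ℝ) * n)) * X 0 n t + c * lam ^ ((n : ℝ) - 1) * X 0 (n - 1) t ^ 2 := by
  simp only [rhsF, Fin.sum_univ_one, Fintype.sum_option, Fin.sum_univ_three]
  simp [feedCoeff, sub_eq_add_neg]
  ring

/-- THE PROFILE `X_n(t) = lam^{-n/5} exp(lam^{4n/5} t)` (decaying into the past). -/
def expX (lam : ℝ) : Fin 1 → ℤ → ℝ → ℝ :=
  fun _ n t => lam ^ (-((1 / 5 : ℝ) * n)) * Real.exp (lam ^ ((4 / 5 : ℝ) * n) * t)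

/-- `Ẋ_n = lam^{4n/5} X_n` for the profile. -/
theorem expX_hasDerivAt (lam : ℝ) (i : Fin 1) (n : ℤ) (t : ℝ) :
    HasDerivAt (expX lam i n) (lam ^ ((4 / 5 : ℝ) * n) * expX lam i n t) t := by
  have h1 : HasDerivAt (fun s : ℝ => lam ^ ((4 / 5 : ℝ) * n) * s) (lam ^ ((4 / 5 : ℝ) * n) * 1) t :=
    (hasDerivAt_id t).const_mul _
  have h2 := (h1.exp).const_mul (lam ^ (-((1 / 5 : ℝ) * n)))
  refine h2.congr_deriv ?_
  simp only [expX]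
  ring

/-- `expX` is exactly 1-DSS, for every `lam > 0`. -/
theorem expX_dss {lam : ℝ} (hlam : 0 < lam) (i : Fin 1) (n : ℤ) (t : ℝ) :
    expX lam i (n + (1 : ℕ)) (lam ^ (-((4 / 5 : ℝ) * (1 : ℕ))) * t) =
      lam ^ (-((1 / 5 : ℝ) * (1 : ℕ))) * expX lam i n t := by
  simp only [expX, Nat.cast_one, mul_one]
  have h1 : lam ^ ((4 / 5 : ℝ) * ((n + 1 : ℤ) : ℝ)) * (lam ^ (-(4 / 5 : ℝ)) * t) =
      lam ^ ((4 / 5 : ℝ) * (n : ℝ)) * t := by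
    push_cast
    have : lam ^ ((4 / 5 : ℝ) * ((n : ℝ) + 1)) * lam ^ (-(4 / 5 : ℝ)) = lam ^ ((4 / 5 : ℝ) * (n : ℝ)) := by
      rw [← Real.rpow_add hlam]; congr 1; ring
    calc lam ^ ((4 / 5 : ℝ) * ((n : ℝ) + 1)) * (lam ^ (-(4 / 5 : ℝ)) * t)
        = (lam ^ ((4 / 5 : ℝ) * ((n : ℝ) + 1)) * lam ^ (-(4 / 5 : ℝ))) * t := by ring
      _ = lam ^ ((4 / 5 : ℝ) * (n : ℝ)) * t := by rw [this]
  have h2 : lam ^ (-((1 / 5 : ℝ) * ((n + 1 : ℤ) : ℝ))) =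
      lam ^ (-(1 / 5 : ℝ)) * lam ^ (-((1 / 5 : ℝ) * (n : ℝ))) := by
    push_cast
    rw [← Real.rpow_add hlam]; congr 1; ring
  rw [h1, h2]
  ring

/-- `expX` is Type I with constant `1`, for every `lam > 0` (`√s·e^{-s} ≤ 1`). -/
theorem expX_typeI {lam : ℝ} (hlam : 0 < lam) (i : Fin 1) (n : ℤ) (t : ℝ) (ht : t < 0) :
    lam ^ ((3 / 5 : ℝ) * n) * |expX lam i n t| ≤ 1 / Real.sqrt (-t) := by
  have hnt : 0 < -t := by linarith
  set a : ℝ := lam ^ ((4 / 5 : ℝ) * n) with ha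
  have hapos : 0 < a := Real.rpow_pos_of_pos hlam _
  have hsq : 0 < Real.sqrt (-t) := Real.sqrt_pos.2 hnt
  simp only [expX]
  rw [abs_mul, abs_of_pos (Real.rpow_pos_of_pos hlam _), abs_of_pos (Real.exp_pos _), ← ha]
  rw [le_div_iff₀ hsq, ← mul_assoc, ← Real.rpow_add hlam]
  have hexp2 : (3 / 5 : ℝ) * n + -((1 / 5 : ℝ) * n) = ((4 / 5 : ℝ) * n) * (1 / 2 : ℝ) := by ring
  rw [hexp2, Real.rpow_mul hlam.le, ← ha, ← Real.sqrt_eq_rpow]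
  -- √a · e^{a t} · √(-t) ≤ 1, i.e. √s e^{-s} ≤ 1 with s = a(-t)
  have hs : Real.sqrt a * Real.sqrt (-t) = Real.sqrt (a * -t) := (Real.sqrt_mul hapos.le _).symm
  have hspos : 0 < a * -t := mul_pos hapos hnt
  have h1 : Real.sqrt (a * -t) ≤ 1 + a * -t := by
    rw [show (1 : ℝ) + a * -t = Real.sqrt ((1 + a * -t) ^ 2) by
      rw [Real.sqrt_sq (by positivity)]]
    apply Real.sqrt_le_sqrt; nlinarith
  have h2 : 1 + a * -t ≤ Real.exp (a * -t) := by
    have := Real.add_one_le_exp (a * -t); linarith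
  have h3 : Real.exp (a * t) * Real.exp (a * -t) = 1 := by rw [← Real.exp_add]; simp
  have hE : 0 < Real.exp (a * t) := Real.exp_pos _
  calc Real.sqrt a * Real.exp (a * t) * Real.sqrt (-t) = Real.exp (a * t) * Real.sqrt (a * -t) := by
        rw [← hs]; ring
    _ ≤ Real.exp (a * t) * Real.exp (a * -t) :=
        mul_le_mul_of_nonneg_left (h1.trans h2) hE.le
    _ = 1 := h3

/-- RESONANCE: at `lam^{4/5} = 2` the profile solves the feed-forward circuit with `c = 2 lam^{3/5}`. -/
theorem expX_solves {lam : ℝ} (hlam : 0 < lam) (hq : lam ^ (4 / 5 : ℝ) = 2) :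
    SolvesODE lam (feedCoeff (2 * lam ^ (3 / 5 : ℝ))) (expX lam) := by
  intro i n t _
  have hi : i = 0 := Subsingleton.elim _ _
  subst hi
  rw [feed_rhs]
  refine (expX_hasDerivAt lam 0 n t).congr_deriv ?_
  simp only [expX]
  -- exponents: 2·lam^{4(n-1)/5} = lam^{4n/5}
  have hclock : lam ^ ((4 / 5 : ℝ) * ((n - 1 : ℤ) : ℝ)) = lam ^ ((4 / 5 : ℝ) * (n : ℝ)) / 2 := by
    rw [eq_div_iff two_ne_zero, ← hq, ← Real.rpow_add hlam]
    push_cast; congr 1; ring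
  have hsqexp : Real.exp (lam ^ ((4 / 5 : ℝ) * ((n - 1 : ℤ) : ℝ)) * t) ^ 2 =
      Real.exp (lam ^ ((4 / 5 : ℝ) * (n : ℝ)) * t) := by
    rw [hclock, sq, ← Real.exp_add]; congr 1; ring
  -- amplitudes: lam^{3/5} · lam^{n-1} · lam^{-2(n-1)/5} = lam^{4n/5} lam^{-n/5}
  have hamp : lam ^ (3 / 5 : ℝ) * lam ^ ((n : ℝ) - 1) * (lam ^ (-((1 / 5 : ℝ) * ((n - 1 : ℤ) : ℝ)))) ^ 2 =
      lam ^ ((4 / 5 : ℝ) * (n : ℝ)) * lam ^ (-((1 / 5 : ℝ) * (n : ℝ))) := by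
    rw [sq]
    simp only [← Real.rpow_add hlam]
    push_cast; congr 1; ring
  rw [mul_pow, hsqexp]
  linear_combination (-2 * Real.exp (lam ^ ((4 / 5 : ℝ) * (n : ℝ)) * t)) * hamp

/-- `2^{5/4} > 1` and `(2^{5/4})^{4/5} = 2`. -/
theorem coarseLam_facts : 1 < (2 : ℝ) ^ (5 / 4 : ℝ) ∧ ((2 : ℝ) ^ (5 / 4 : ℝ)) ^ (4 / 5 : ℝ) = 2 := by
  constructor
  · exact Real.one_lt_rpow (by norm_num) (by norm_num)
  · rw [← Real.rpow_mul (by norm_num)]; norm_num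

/-- An explicit NON-CONSERVATIVE PUMP at `lam = 2^{5/4}`: symmetric, not cyclic-cancelling, exactly 1-DSS, Type I,
nontrivial, ancient. -/
theorem nonConservativePump :
    ∃ (coeff : Fin 1 → Fin 1 → Fin 1 → Option (Fin 3) → ℝ) (X : Fin 1 → ℤ → ℝ → ℝ),
      IsSym coeff ∧ ¬ IsCyc coeff ∧ SolvesODE ((2 : ℝ) ^ (5 / 4 : ℝ)) coeff X ∧
        IsDSS ((2 : ℝ) ^ (5 / 4 : ℝ)) 1 X ∧ IsTypeI ((2 : ℝ) ^ (5 / 4 : ℝ)) X ∧ IsNontrivial X := by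
  obtain ⟨h1, hq⟩ := coarseLam_facts
  set lam : ℝ := (2 : ℝ) ^ (5 / 4 : ℝ) with hlam
  have hpos : 0 < lam := by linarith
  refine ⟨feedCoeff (2 * lam ^ (3 / 5 : ℝ)), expX lam, isSym_feedCoeff _, ?_, expX_solves hpos hq, ?_, ?_, ?_⟩
  · exact not_isCyc_feedCoeff (mul_ne_zero two_ne_zero (Real.rpow_pos_of_pos hpos _).ne')
  · intro i n t _; exact expX_dss hpos i n t
  · exact ⟨1, fun i n t ht => expX_typeI hpos i n t ht⟩
  · refine ⟨0, 0, -1, by norm_num, ?_⟩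
    simp only [expX]
    exact mul_ne_zero (Real.rpow_pos_of_pos hpos _).ne' (Real.exp_pos _).ne'

/-- **ENERGY CONSERVATION IS LOAD-BEARING (at `lam = 2^{5/4}`)**: the crux with `IsCyc` deleted holds as soon as
the fineness threshold is raised to `2^{5/4}`. Any disproof of `CircuitPump` must therefore use the cyclic
cancellation or the fineness `lam < 2^{5/4}`. -/
theorem withoutCycAbove_holds : WithoutCycAbove ((2 : ℝ) ^ (5 / 4 : ℝ)) := by
  intro lam₀ hlam₀
  obtain ⟨h1, _⟩ := coarseLam_facts
  obtain ⟨coeff, X, hS, _, hode, hdss, hTI, hnt⟩ := nonConservativePump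
  exact ⟨(2 : ℝ) ^ (5 / 4 : ℝ), h1, hlam₀, 1, coeff, 1, X, hS, le_rfl, hode, hdss, hTI, hnt⟩

end Summit.NavierStokesRegularity.NavierStokesRegularity.Theorems.CircuitPumpNegative
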